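import Mathlib
import Summits.Ventures.PercRepro2.RowC1E1Avoid
import Summits.Ventures.PercRepro2.BHKPair

/-!
# The cluster-conditioned sharpening (C1-H′) of row 2′C1 and (C1-H′) ⟹ (E1)
(blind cell PercRepro2, p2 g30; proofs/P2-G30-C1.md §3)

With `Q = {a₁ ↮ a₂}`, `C₁ = C(a₁)`, `C₂ = C(a₂)`, `U = C₁ ∪ C₂`, `μ = P(· | Q)`, explore the cluster
`C₂ = W`; on `Q` the cluster of `a₁` is its cluster in the fresh graph `G ∖ W` (`delConfig`), so
`α̂_x(W) := P_{G∖W}(x ∈ C(a₁))·1[x ∉ W]` (`freshIn`) is the conditional probability `μ(x ∈ C₁ | C₂ = W)`.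
The sharpening of record of this seat is

  **(C1-H′)**  `Cov_μ(1[b ∈ C₂], 1[o ∈ U]) ≥ −E_μ[ α̂_b(C₂)·α̂_o(C₂) ]`,

cleared by `P(Q)²`: `P(Q, b ∈ C₂)·P(Q, o ∈ U) ≤ P(Q)·(P(Q, b ∈ C₂, o ∈ U) + E[α̂_b(C₂) α̂_o(C₂) 1_Q])`
(`C1HCond`).  In words: the anticorrelation of `{b ∈ C₂}` and `{o ∈ U}` is at most the probability,
under the coupling of two copies sharing the cluster `C₂` and independent outside it, that `b ∈ C₁`
in the first copy and `o ∈ C₁` in the second.  **`e1_of_c1hcond`** below is `C1HCond ⟹ E1Cov`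
(hence ⟹ row 2′C1 by `c1_of_e1`): Harris' inequality in the fresh graph `G ∖ W` gives
`α̂_b(W)·α̂_o(W) ≤ P_{G∖W}(b, o ∈ C(a₁))·1[b, o ∉ W]`, and the tower identity
`expect_pair_mul_indicator` turns the right side, integrated against `1_Q`, into `P(Q, b ∈ C₁, o ∈ C₁)`.
(C1-H′) is a CONJECTURE of the cell (exact census 0 / 2,400 at n ≤ 6, log-odds descents 0 / 1,287;
proofs/P2-G30-C1.md §3), not a fact.
-/

namespace Summit.Ventures.PercRepro2

namespace RowC1

section HCond

open Classical

variable {V : Type*} {E : Type*} [Fintype E] [DecidableEq E] [Fintype V] [DecidableEq V]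
  {R : Type*} [CommRing R] [LinearOrder R] [IsStrictOrderedRing R]

/-- `markIn x W C = 1[x ∉ W, x ∈ C]`: the mark `x` lies in the second cluster and outside the first. -/
noncomputable def markIn (x : V) (W C : Set V) : R := if x ∉ W ∧ x ∈ C then 1 else 0

omit [Fintype E] [DecidableEq E] [Fintype V] [DecidableEq V] in
/-- `markIn x W ·` is increasing in the second cluster. -/
lemma markIn_mono (x : V) (W : Set V) {C C' : Set V} (h : C ⊆ C') :
    (markIn x W C : R) ≤ markIn x W C' := by
  unfold markIn
  by_cases hx : x ∉ W ∧ x ∈ C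
  · rw [if_pos hx, if_pos ⟨hx.1, h hx.2⟩]
  · rw [if_neg hx]
    split_ifs <;> norm_num

omit [Fintype E] [DecidableEq E] [Fintype V] [DecidableEq V] in
/-- `markIn` is nonnegative. -/
lemma markIn_nonneg (x : V) (W C : Set V) : (0 : R) ≤ markIn x W C := by
  unfold markIn; split_ifs <;> norm_num

/-- `α̂_x(W) = P_{G∖W}(x ∈ C(a₁))·1[x ∉ W]`: the fresh probability, with every edge at `W` closed,
that `x` lies in the cluster of `a₁`. -/
noncomputable def freshIn (p : E → R) (ends : E → Sym2 V) (a₁ x : V) (W : Set V) : R :=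
  expect p (fun ω' => markIn x W (cluster ends (delConfig ends W ω') a₁))

/-- `P_{G∖W}(b, o ∈ C(a₁))·1[b, o ∉ W]`. -/
noncomputable def freshBoth (p : E → R) (ends : E → Sym2 V) (a₁ o b : V) (W : Set V) : R :=
  expect p (fun ω' => markIn b W (cluster ends (delConfig ends W ω') a₁) *
    markIn o W (cluster ends (delConfig ends W ω') a₁))

omit [Fintype V] [DecidableEq V] in
/-- **Harris in `G ∖ W`**: `α̂_b(W)·α̂_o(W) ≤ P_{G∖W}(b, o ∈ C(a₁))·1[b, o ∉ W]` — both are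
increasing functions of the configuration of `G ∖ W`. -/
lemma freshIn_mul_le (p : E → R) (hp : IsProbVec p) (ends : E → Sym2 V) (a₁ o b : V)
    (W : Set V) :
    freshIn p ends a₁ b W * freshIn p ends a₁ o W ≤ freshBoth p ends a₁ o b W := by
  unfold freshIn freshBoth
  have hf : Monotone (fun ω' => (markIn b W (cluster ends (delConfig ends W ω') a₁) : R)) := by
    intro ω ω' h
    exact markIn_mono b W (cluster_mono (BHKPair.delConfig_mono_config ends W h) a₁)
  have hg : Monotone (fun ω' => (markIn o W (cluster ends (delConfig ends W ω') a₁) : R)) := by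
    intro ω ω' h
    exact markIn_mono o W (cluster_mono (BHKPair.delConfig_mono_config ends W h) a₁)
  have key := expect_mul_expect_le_expect_mul hp hf hg
  have e : ((fun ω' => (markIn b W (cluster ends (delConfig ends W ω') a₁) : R)) *
      fun ω' => (markIn o W (cluster ends (delConfig ends W ω') a₁) : R)) =
      fun ω' => (markIn b W (cluster ends (delConfig ends W ω') a₁) : R) *
        markIn o W (cluster ends (delConfig ends W ω') a₁) := by
    funext ω'; rfl
  rw [e] at key
  exact key

/-- The shared-cluster compensation `E[α̂_b(C₂)·α̂_o(C₂)·1_Q]` (with `Q` written as `{a₂ ↮ a₁}`). -/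
noncomputable def sharedComp (p : E → R) (ends : E → Sym2 V) (a₁ a₂ o b : V) : R :=
  expect p (fun ω => freshIn p ends a₁ b (cluster ends ω a₂) *
    freshIn p ends a₁ o (cluster ends ω a₂) * ((connEvent ends a₂ a₁)ᶜ).indicator 1 ω)

/-- **(C1-H′)**, cleared by `P(Q)²`:
`P(Q, b ∈ C₂)·P(Q, o ∈ U) ≤ P(Q)·(P(Q, b ∈ C₂, o ∈ U) + E[α̂_b(C₂)·α̂_o(C₂)·1_Q])`.
A CONJECTURE (p2 g30; the cluster-conditioned sharpening of record of row 2′C1). -/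
def C1HCond (p : E → R) (ends : E → Sym2 V) (a₁ a₂ o b : V) : Prop :=
  prob p (connEvent ends a₂ b ∩ (connEvent ends a₁ a₂)ᶜ) *
      prob p ((connEvent ends a₁ o ∪ connEvent ends a₂ o) ∩ (connEvent ends a₁ a₂)ᶜ) ≤
    prob p (connEvent ends a₁ a₂)ᶜ *
      (prob p (connEvent ends a₂ b ∩ (connEvent ends a₁ o ∪ connEvent ends a₂ o) ∩
          (connEvent ends a₁ a₂)ᶜ) +
        sharedComp p ends a₁ a₂ o b)

omit [Fintype E] [DecidableEq E] [Fintype V] [DecidableEq V] [LinearOrder R] [IsStrictOrderedRing R] in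
/-- `connEvent` is symmetric. -/
lemma connEvent_symm' (ends : E → Sym2 V) (u v : V) : connEvent ends u v = connEvent ends v u := by
  ext ω
  exact ⟨fun h => conn_symm h, fun h => conn_symm h⟩

omit [DecidableEq V] in
/-- **The compensation is at most `P(Q, b ∈ C₁, o ∈ C₁)`**: Harris in `G ∖ C₂` and the tower
identity. -/
lemma sharedComp_le (p : E → R) (hp : IsProbVec p) (ends : E → Sym2 V) (a₁ a₂ o b : V) :
    sharedComp p ends a₁ a₂ o b ≤
      prob p (connEvent ends a₁ b ∩ connEvent ends a₁ o ∩ (connEvent ends a₁ a₂)ᶜ) := by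
  unfold sharedComp
  -- step 1: Harris in the fresh graph, cluster by cluster
  have h1 : expect p (fun ω => freshIn p ends a₁ b (cluster ends ω a₂) *
      freshIn p ends a₁ o (cluster ends ω a₂) * ((connEvent ends a₂ a₁)ᶜ).indicator 1 ω) ≤
      expect p (fun ω => freshBoth p ends a₁ o b (cluster ends ω a₂) *
        ((connEvent ends a₂ a₁)ᶜ).indicator 1 ω) := by
    refine expect_mono hp fun ω => ?_
    refine mul_le_mul_of_nonneg_right (freshIn_mul_le p hp ends a₁ o b _) ?_
    exact Set.indicator_nonneg (fun _ _ => zero_le_one) ω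
  -- step 2: the tower identity
  have h2 : expect p (fun ω => freshBoth p ends a₁ o b (cluster ends ω a₂) *
      ((connEvent ends a₂ a₁)ᶜ).indicator 1 ω) =
      expect p (fun ω => (markIn b (cluster ends ω a₂) (cluster ends ω a₁) *
        markIn o (cluster ends ω a₂) (cluster ends ω a₁) : R) *
        ((connEvent ends a₂ a₁)ᶜ).indicator 1 ω) := by
    have := BHKPair.expect_pair_mul_indicator p ends a₂ a₁
      (fun W C => (markIn b W C * markIn o W C : R))
    unfold freshBoth
    exact this.symm
  -- step 3: on `Q`, `1[b ∉ C₂, b ∈ C₁]·1[o ∉ C₂, o ∈ C₁]` is the indicator of `{b ∈ C₁, o ∈ C₁}`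
  have h3 : expect p (fun ω => (markIn b (cluster ends ω a₂) (cluster ends ω a₁) *
        markIn o (cluster ends ω a₂) (cluster ends ω a₁) : R) *
        ((connEvent ends a₂ a₁)ᶜ).indicator 1 ω) =
      prob p (connEvent ends a₁ b ∩ connEvent ends a₁ o ∩ (connEvent ends a₁ a₂)ᶜ) := by
    rw [prob_eq_expect_indicator]
    unfold expect
    refine Finset.sum_congr rfl fun ω _ => ?_
    congr 1
    beta_reduce
    by_cases hQ : ω ∈ (connEvent ends a₁ a₂)ᶜ
    · have hQ' : ω ∈ (connEvent ends a₂ a₁)ᶜ := by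
        rw [connEvent_symm' ends a₂ a₁]; exact hQ
      rw [Set.indicator_of_mem hQ', Pi.one_apply, mul_one]
      by_cases hbl : ω ∈ connEvent ends a₁ b
      · by_cases hol : ω ∈ connEvent ends a₁ o
        · rw [Set.indicator_of_mem (show ω ∈ connEvent ends a₁ b ∩ connEvent ends a₁ o ∩
            (connEvent ends a₁ a₂)ᶜ from ⟨⟨hbl, hol⟩, hQ⟩), Pi.one_apply]
          have hb2 : b ∉ cluster ends ω a₂ := fun h => hQ (conn_trans hbl (conn_symm h))
          have ho2 : o ∉ cluster ends ω a₂ := fun h => hQ (conn_trans hol (conn_symm h))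
          have hb1 : b ∈ cluster ends ω a₁ := hbl
          have ho1 : o ∈ cluster ends ω a₁ := hol
          unfold markIn
          rw [if_pos (show b ∉ cluster ends ω a₂ ∧ b ∈ cluster ends ω a₁ from ⟨hb2, hb1⟩),
            if_pos (show o ∉ cluster ends ω a₂ ∧ o ∈ cluster ends ω a₁ from ⟨ho2, ho1⟩), mul_one]
        · rw [Set.indicator_of_notMem (show ω ∉ connEvent ends a₁ b ∩ connEvent ends a₁ o ∩
            (connEvent ends a₁ a₂)ᶜ from fun h => hol h.1.2)]
          have ho1 : ¬ (o ∉ cluster ends ω a₂ ∧ o ∈ cluster ends ω a₁) := fun h => hol h.2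
          unfold markIn
          rw [if_neg ho1, mul_zero]
      · rw [Set.indicator_of_notMem (show ω ∉ connEvent ends a₁ b ∩ connEvent ends a₁ o ∩
            (connEvent ends a₁ a₂)ᶜ from fun h => hbl h.1.1)]
        have hb1 : ¬ (b ∉ cluster ends ω a₂ ∧ b ∈ cluster ends ω a₁) := fun h => hbl h.2
        unfold markIn
        rw [if_neg hb1, zero_mul]
    · have hQ' : ω ∉ (connEvent ends a₂ a₁)ᶜ := by
        rw [connEvent_symm' ends a₂ a₁]; exact hQ
      rw [Set.indicator_of_notMem hQ', Set.indicator_of_notMem (fun h => hQ h.2), mul_zero]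
  calc _ ≤ _ := h1
    _ = _ := h2
    _ = _ := h3

omit [DecidableEq V] in
/-- **(E1) from (C1-H′)**: `C1HCond` gives `E1Cov`, hence row 2′C1 (`c1_of_e1`). -/
theorem e1_of_c1hcond (p : E → R) (hp : IsProbVec p) (ends : E → Sym2 V) (a₁ a₂ o b : V)
    (h : C1HCond p ends a₁ a₂ o b) : E1Cov p ends a₁ a₂ o b := by
  unfold C1HCond at h
  unfold E1Cov
  exact h.trans (mul_le_mul_of_nonneg_left
    (add_le_add (le_refl _) (sharedComp_le p hp ends a₁ a₂ o b)) (prob_nonneg hp _))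

end HCond

end RowC1

end Summit.Ventures.PercRepro2
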